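import Summits.Parity.BatemanHorn.Theorems.SoloInformedChebyshevHooleyRows
import HarnessLib

/-!
# The Chebyshev–Hooley moduli sequence: no level of distribution beyond `X^{1+o(1)}`

Type-I companion of `SoloInformedChebyshevHooleyRows`.  For the moduli count
`c_X(k) = #{1 ≤ ℓ ≤ X : k ∣ ℓ² + 1}` (inline: `#((Icc 1 X).filter (k ∣ ·² + 1))`) and ANY model
`b ≥ 0` on a box of moduli `d ∈ R` and multipliers `j ∈ C` with row sums `≤ ρ`, the level-`R` Type-I
sum obeys `∑_{d ∈ R} |∑_{j ∈ C} (c_X(jd) − b(jd))| ≥ ∑_{R×C} b − (∑_{ℓ ≤ X} τ(ℓ²+1)) · ρ`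
(`chebyshevHooley_typeI`; power form `chebyshevHooley_typeI_rpow` with `C_ε X (X²+1)^ε ρ`): the dead
moduli (those dividing no `ℓ² + 1`, `ℓ ≤ X` — all but `≤ ∑_{ℓ≤X} τ(ℓ²+1) = X^{1+o(1)}` of them)
contribute their full model mass.  Reading: with `R = (D, 2D]`, `C = (J, 2J]`, `DJ = K = X^α` and
the Grimmelt–Merikoski model `b(k) = X∫ψ · ρ(k)/k` (`ρ ≤ X^{1+o(1)}/D`), the right side is
`(model mass) − X^{2+o(1)}/D`; so a level of distribution `D` for the moduli sequence against its
model — in the absolute-value form of [arXiv:2505.00493, Theorem 1.4], proved there for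
`D ≤ X^{1/2}` — is impossible for `D ≥ X^{1+ε}`, i.e. beyond `K^{1/α+o(1)}` in units of the modulus
size; at the top rung `α = 2` this is the classical `K^{1/2}` ceiling of the value sequence
(`eventually_not_typeI_sq_add_one`).  The interval `X^{1/2} < D ≤ X` is the only place where Type-I
progress on this ladder is conceivable. [folklore]
-/

noncomputable section

open Finset

namespace Summit.Parity.BatemanHorn.Theorems

/-- **Dead moduli carry their model mass into every Type-I sum.**  For all `X`, moduli `R`,
multipliers `C`, models `b ≥ 0` on the box with row sums `≤ ρ` (`ρ ≥ 0`):
`∑_{d ∈ R} |∑_{j ∈ C} (c_X(jd) − b(jd))| ≥ ∑_{R×C} b − (∑_{ℓ≤X} τ(ℓ²+1)) · ρ`. [folklore] -/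
theorem chebyshevHooley_typeI (X : ℕ) (R C : Finset ℕ) (b : ℕ → ℝ)
    (hb : ∀ d ∈ R, ∀ j ∈ C, 0 ≤ b (j * d)) {ρ : ℝ} (hρ : 0 ≤ ρ)
    (hrow : ∀ d ∈ R, ∑ j ∈ C, b (j * d) ≤ ρ) :
    (∑ d ∈ R, ∑ j ∈ C, b (j * d)) - (∑ ℓ ∈ Icc 1 X, (#(ℓ ^ 2 + 1).divisors : ℝ)) * ρ ≤
      ∑ d ∈ R, |∑ j ∈ C,
        ((#((Icc 1 X).filter (fun ℓ : ℕ => j * d ∣ ℓ ^ 2 + 1)) : ℝ) - b (j * d))| := by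
  obtain ⟨β, hβ, hsum⟩ := chebyshevHooley_rows X R C b hb hρ hrow
  refine le_trans hsum ?_
  refine le_trans (abs_sum_le_sum_abs _ _) (sum_le_sum fun d _ => ?_)
  rw [abs_mul]
  have hβ1 : |β d| ≤ 1 := by
    rcases hβ d with h | h <;> simp [h]
  calc |β d| *
        |∑ j ∈ C, ((#((Icc 1 X).filter (fun ℓ : ℕ => j * d ∣ ℓ ^ 2 + 1)) : ℝ) - b (j * d))|
      ≤ 1 * |∑ j ∈ C,
          ((#((Icc 1 X).filter (fun ℓ : ℕ => j * d ∣ ℓ ^ 2 + 1)) : ℝ) - b (j * d))| :=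
        mul_le_mul_of_nonneg_right hβ1 (abs_nonneg _)
    _ = _ := one_mul _

/-- **Power form.**  For every `ε > 0` there is `C_ε ≥ 1` such that for all `X`, `R`, `C`, `b ≥ 0`
with row sums `≤ ρ` (`ρ ≥ 0`):
`∑_{d ∈ R} |∑_{j ∈ C} (c_X(jd) − b(jd))| ≥ ∑_{R×C} b − C_ε X (X²+1)^ε ρ`. [folklore] -/
theorem chebyshevHooley_typeI_rpow {ε : ℝ} (hε : 0 < ε) :
    ∃ Cε : ℝ, 1 ≤ Cε ∧ ∀ (X : ℕ) (R C : Finset ℕ) (b : ℕ → ℝ),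
      (∀ d ∈ R, ∀ j ∈ C, 0 ≤ b (j * d)) → ∀ {ρ : ℝ}, 0 ≤ ρ →
      (∀ d ∈ R, ∑ j ∈ C, b (j * d) ≤ ρ) →
        (∑ d ∈ R, ∑ j ∈ C, b (j * d)) - Cε * X * ((X : ℝ) ^ 2 + 1) ^ ε * ρ ≤
          ∑ d ∈ R, |∑ j ∈ C,
            ((#((Icc 1 X).filter (fun ℓ : ℕ => j * d ∣ ℓ ^ 2 + 1)) : ℝ) - b (j * d))| := by
  obtain ⟨Cε, hC1, hC⟩ := sum_card_divisors_sq_add_one_le hε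
  refine ⟨Cε, hC1, fun X R C b hb ρ hρ hrow => ?_⟩
  have h := chebyshevHooley_typeI X R C b hb hρ hrow
  have := mul_le_mul_of_nonneg_right (hC X) hρ
  linarith

end Summit.Parity.BatemanHorn.Theorems

end
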